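import Summits.QuantumFields.QCD.Theses.HeatSlicedQuarks
import Literature.MathematicalPhysics.QuantumLattice.OverlapLocality
import Literature.MathematicalPhysics.QuantumLattice.DuhamelTwoPoint
import Summits.QuantumFields.QCD.Theorems.ActionBoundsLowModes.Negative.LoadBearing
import Summits.QuantumFields.QCD.Theorems.HeatSlicedQuarksActionBoundsLowModesStubCurvSqLeAction
import Summits.QuantumFields.QCD.Theorems.HeatSlicedQuarksActionBoundsLowModesStubLatticeSum
import Summits.QuantumFields.QCD.Theorems.HeatSlicedQuarksActionBoundsLowModesStubStaircase
import Summits.QuantumFields.QCD.Theorems.HeatSlicedQuarksActionBoundsLowModesStubBesselCount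
import Summits.QuantumFields.QCD.Theorems.HeatSlicedQuarksUniformLocalSpectralBound
import Summits.QuantumFields.QCD.Theorems.HeatSlicedQuarksActionBoundsLowModesStubNaiveKinetic
import Summits.QuantumFields.QCD.Theorems.HeatSlicedQuarksActionBoundsLowModesStubDomination
import Summits.QuantumFields.QCD.Theorems.HeatSlicedQuarksActionBoundsLowModesStubFreeResolventFourier
import Summits.QuantumFields.QCD.Theorems.HeatSlicedQuarksActionBoundsLowModesAbstractCLR

/-!
# Line `Sketch` (idea `drop-the-wilson-square`) for crux `HeatSlicedQuarks.ActionBoundsLowModes`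
(item stmt-QuantumFields-8872, route route-QuantumFields-HeatSlicedQuarks) — THE CRUX PROOF

Lead prover-line-stmt-QuantumFields-8872-0, 2026-08-16.  Every `stub_*` of the line is a LANDED theorem under
`Theorems/HeatSlicedQuarksActionBoundsLowModes*.lean` (imported above); `ActionBoundsLowModes_of` is the sorry-free
composition concluding the crux `HeatSlicedQuarks.ActionBoundsLowModes` BY NAME.

## Mechanism

Write `F_μ = linkHop ρ₃ U μ` (covariant forward shift on site ⊗ colour, unitary) and
`D = D_W(U,m,1) = (m+4)·1 − Σ_μ W_μ`, `W_μ = F_μ ⊗ ½(1−γ_μ) + F_μᴴ ⊗ ½(1+γ_μ)`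
(`wilsonDirac_eq_sub_sum_wilsonHop`).  With `a_μ = F_μ − F_μᴴ` (anti-Hermitian) the NAIVE KINETIC
operator is `Tn(U) = (Σ_μ a_μᴴ a_μ) ⊗ 1_spin = (8 − Σ_μ (F_μ² + F_μᴴ²)) ⊗ 1` — the covariant Laplacian of
the DOUBLED links `U(x,μ)U(x+μ̂,μ)` on double steps.

1. `stub_naiveKinetic` (Neuberger's square completion read for counting, ALL masses):
   `Re⟨v, Tn v⟩ ≤ 4‖Dv‖² + C_A Σ_x V(U,x)|v(x)|²`, `V` the curvature potential of `WilsonLichnerowicz`.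
2. `stub_curvSqLeAction`: `Σ_x V(U,x)² ≤ C_B · wilsonAction` (Cauchy–Schwarz, `|ball(3)| ≤ 7⁴`).
3. Local Weyl law for `Tn`, holonomy-blind, in resolvent-fourth-power form:
   `stub_domination` (Kato/M-matrix: `|((Tn+ε)⁻¹)⁴(i,i)| ≤ ((T₀+ε)⁻¹)⁴(x,x)` with `T₀` the free scalar
   double-step Laplacian of the torus), `stub_freeResolventFourier` (torus Fourier:
   `((T₀+ε)⁻¹)⁴(x,x) ≤ L⁻⁴ Σ_k (Σ_μ 4 sin²(2πk_μ/L) + ε)⁻⁴`), `stub_latticeSum`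
   (`L⁻⁴ Σ_k (…)⁻⁴ ≤ K₁(1/ε² + 1/(ε⁴L⁴))`: AM–GM makes the summand separable,
   `(Σ_μ b_μ)⁻⁴ ≤ Π_μ b_μ⁻¹/256`, leaving a one-dimensional sum).
4. Abstract finite-dimensional CLR (Cwikel's staircase à la Frank/Rumin, min–max free), split as
   `stub_staircase` (Cauchy–Schwarz across dyadic anti-diagonals: the high-energy part of
   `W^{1/2}T^{-1/2}` has norm ≤ ½), `stub_besselCount` (a subspace on which `‖g‖ ≤ 2‖Mg‖` has
   `dim ≤ 4‖M‖²_HS`), and the lead's `stub_abstractCLR` (Birman–Schwinger vectors + weighted local Weyl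
   law from the resolvent cube + the two previous stubs):
   `T ≻ 0`, `Re((T+E)⁻⁴)(i,i) ≤ K/E²` (∀E>0), `Re⟨u,Tu⟩ ≤ Σ W_i|u_i|²` on `F` ⟹ `dim F ≤ c₁ K Σ_i W_i²`.
5. Glue (`ActionBoundsLowModes_of`): on `E`, `Re⟨v,(Tn+κ)v⟩ ≤ Σ_i (4λ + C_A V(x_i) + κ)|v_i|²` with
   `κ = L⁻²`; the local Weyl constant is `2·max(K₁,1)` because `(κ+E)⁴L⁴ ≥ 6E²`; hence
   `dim E ≤ c₁K·12·3·(16λ²L⁴ + C_A² C_B S_W + 1)`.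

Disproof used: `Cruxes/ActionBoundsLowModes/Disproof.lean` v1 (no kill; load-bearing terms `+1`,
`λ²L⁴` kept; no `-- Targets` yet).  Imports the landed `Negative.LoadBearing` (`re_trace…`, `wilsonAction_nonneg`).
-/

namespace Summit.QuantumFields.QCD.Cruxes.ActionBoundsLowModes.DropTheWilsonSquare

open Literature.MathematicalPhysics Literature.MathematicalPhysics.QuantumLattice
  Literature.MathematicalPhysics.QuantumFieldTheory Literature.Probability.LatticeModels
open Matrix
open scoped Kronecker ComplexOrder

/-! ## Stub A — the all-mass naive kinetic bound (worker) -/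

-- `stub_naiveKinetic` LANDED: imported from the tree (see imports).

/-! ## Stub B — curvature potential squared is paid by the action (worker) -/

-- `stub_curvSqLeAction` LANDED: imported from the tree (see imports).

/-! ## Stubs C2a–c — the holonomy-blind local Weyl law for the naive kinetic operator (workers) -/

-- `stub_domination` LANDED: imported from the tree (see imports).

-- `stub_freeResolventFourier` LANDED: imported from the tree (see imports).

-- `stub_latticeSum` LANDED: imported from the tree (see imports).

/-! ## Stubs C1a–b and the lead's abstract CLR engine -/

-- `stub_staircase` LANDED: imported from the tree (see imports).

-- `stub_besselCount` LANDED: imported from the tree (see imports).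

-- `stub_abstractCLR` LANDED: imported from the tree (see imports).

/-! ## The composition: the stubs imply the crux (concluded by name) -/

/-- `(Σ_μ A_μ) ⊗ 1 = Σ_μ (A_μ ⊗ 1)` (entrywise). -/
private theorem glue_sum_kronecker_one {m p : Type*} [Fintype p] [DecidableEq p] {ι : Type*}
    (s : Finset ι) (A : ι → Matrix m m ℂ) :
    (∑ μ ∈ s, A μ) ⊗ₖ (1 : Matrix p p ℂ) = ∑ μ ∈ s, A μ ⊗ₖ (1 : Matrix p p ℂ) := by
  ext ⟨i, k⟩ ⟨j, l⟩
  simp only [Matrix.kroneckerMap_apply, Matrix.sum_apply, Finset.sum_mul]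

/-- A Gram matrix tensored with the identity is positive semidefinite. -/
private theorem glue_posSemidef_gram_kronecker_one {m p : Type*} [Fintype m] [Fintype p] [DecidableEq p]
    (X : Matrix m m ℂ) : ((Xᴴ * X) ⊗ₖ (1 : Matrix p p ℂ)).PosSemidef := by
  have h : (Xᴴ * X) ⊗ₖ (1 : Matrix p p ℂ) = (X ⊗ₖ (1 : Matrix p p ℂ))ᴴ * (X ⊗ₖ (1 : Matrix p p ℂ)) := by
    rw [Matrix.conjTranspose_kronecker, Matrix.conjTranspose_one, ← Matrix.mul_kronecker_mul,
      Matrix.one_mul]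
  rw [h]
  exact Matrix.posSemidef_conjTranspose_mul_self _

/-- `Σ_{(x,a,α)} g(x) = 12 Σ_x g(x)` on site × colour × spin. -/
private theorem glue_sum_site_twelve {L : ℕ} [NeZero L] (g : TorusSite 4 L → ℝ) :
    ∑ i : TorusSite 4 L × Fin 3 × Fin 4, g i.1 = 12 * ∑ x : TorusSite 4 L, g x := by
  rw [Fintype.sum_prod_type, Finset.mul_sum]
  refine Finset.sum_congr rfl fun x _ => ?_
  show ∑ _p : Fin 3 × Fin 4, g x = 12 * g x
  rw [Finset.sum_const, Finset.card_univ, nsmul_eq_mul]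
  norm_num [Fintype.card_prod, Fintype.card_fin]

set_option maxHeartbeats 800000 in
/-- **The skeleton IS the crux proof modulo the registered stubs.**  `ActionBoundsLowModes_of` concludes
`HeatSlicedQuarks.ActionBoundsLowModes` BY NAME from `stub_naiveKinetic`, `stub_curvSqLeAction`,
`stub_domination`, `stub_freeResolventFourier`, `stub_latticeSum`, `stub_abstractCLR` (the latter proved by
the lead from `stub_staircase`, `stub_besselCount`).  Glue: `κ = L⁻²`, `T = Tn(U) + κ`, weight
`W_i = 4λ + C_A V(U,x_i) + κ`, local Weyl constant `K = 2 max(K₁,1)` (since `(κ+E)⁴ L⁴ ≥ 6E²`), and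
`Σ_i W_i² ≤ 36 (16 λ²L⁴ + C_A² C_B S_W + 1)`. -/
theorem ActionBoundsLowModes_of :
    Summit.QuantumFields.QCD.Theses.HeatSlicedQuarks.ActionBoundsLowModes := by
  obtain ⟨C_A, hA⟩ := stub_naiveKinetic
  obtain ⟨C_B, hB⟩ := stub_curvSqLeAction
  obtain ⟨K₁, hK₁⟩ := stub_latticeSum
  obtain ⟨c₁, hc₁⟩ := stub_abstractCLR
  have hdom := stub_domination
  have hfou := stub_freeResolventFourier
  classical
  -- nonnegative versions of the constants
  have hCA : C_A ≤ max C_A 0 := le_max_left _ _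
  have hCA0 : 0 ≤ max C_A 0 := le_max_right _ _
  set CA : ℝ := max C_A 0 with hCAdef
  have hCB : C_B ≤ max C_B 0 := le_max_left _ _
  have hCB0 : 0 ≤ max C_B 0 := le_max_right _ _
  set CB : ℝ := max C_B 0 with hCBdef
  have hK1 : K₁ ≤ max K₁ 1 := le_max_left _ _
  have hK11 : 1 ≤ max K₁ 1 := le_max_right _ _
  set K1 : ℝ := max K₁ 1 with hK1def
  have hK10 : 0 ≤ K1 := zero_le_one.trans hK11
  have hc1 : c₁ ≤ max c₁ 0 := le_max_left _ _
  have hc10 : 0 ≤ max c₁ 0 := le_max_right _ _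
  set c1 : ℝ := max c₁ 0 with hc1def
  refine ⟨36 * c1 * (2 * K1) * (16 + CA ^ 2 * CB + 1), ?_⟩
  intro L _ U m _hm lam hlam E hE
  -- real-number facts about `L` and `κ = L⁻²`
  have hL1 : (1 : ℝ) ≤ L := by exact_mod_cast Nat.one_le_iff_ne_zero.mpr (NeZero.ne L)
  have hL0 : (0 : ℝ) < L := zero_lt_one.trans_le hL1
  set κ : ℝ := 1 / (L : ℝ) ^ 2 with hκdef
  have hκ0 : 0 < κ := by positivity
  have hκL : κ * (L : ℝ) ^ 2 = 1 := by
    rw [hκdef]; field_simp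
  -- the objects
  set ρ₃ := fundamentalRep (Fin 3) with hρ₃
  set Tn : Matrix (TorusSite 4 L × Fin 3 × Fin 4) (TorusSite 4 L × Fin 3 × Fin 4) ℂ :=
    Matrix.reindex (Equiv.prodAssoc (TorusSite 4 L) (Fin 3) (Fin 4))
        (Equiv.prodAssoc (TorusSite 4 L) (Fin 3) (Fin 4))
      ((∑ μ : Fin 4, (linkHop ρ₃ U μ - (linkHop ρ₃ U μ)ᴴ)ᴴ * (linkHop ρ₃ U μ - (linkHop ρ₃ U μ)ᴴ)) ⊗ₖ
        (1 : Matrix (Fin 4) (Fin 4) ℂ)) with hTndef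
  set T : Matrix (TorusSite 4 L × Fin 3 × Fin 4) (TorusSite 4 L × Fin 3 × Fin 4) ℂ :=
    Tn + (κ : ℂ) • (1 : Matrix _ _ ℂ) with hTdef
  set curv : TorusSite 4 L → ℝ := fun x =>
    ∑ y ∈ Finset.univ.filter (fun y : TorusSite 4 L => torusDist x y ≤ 3), ∑ μ : Fin 4, ∑ ν : Fin 4,
      Real.sqrt (3 - (ρ₃ (plaquetteHolonomy U y μ ν)).trace.re) with hcurvdef
  have hcurv0 : ∀ x, 0 ≤ curv x := fun x =>
    Finset.sum_nonneg fun _ _ => Finset.sum_nonneg fun _ _ => Finset.sum_nonneg fun _ _ =>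
      Real.sqrt_nonneg _
  set W : TorusSite 4 L × Fin 3 × Fin 4 → ℝ := fun i => 4 * lam + CA * curv i.1 + κ with hWdef
  have hW : ∀ i, 0 < W i := fun i => by
    have : 0 ≤ 4 * lam + CA * curv i.1 := by positivity
    show 0 < 4 * lam + CA * curv i.1 + κ
    linarith
  -- `T` is positive definite
  have hTn : Tn.PosSemidef := by
    rw [hTndef, Matrix.reindex_apply, glue_sum_kronecker_one]
    refine Matrix.PosSemidef.submatrix ?_ _
    exact Matrix.posSemidef_sum _ fun μ _ => glue_posSemidef_gram_kronecker_one _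
  have hT : T.PosDef := by
    rw [hTdef]
    refine Matrix.PosDef.posSemidef_add hTn ?_
    rw [Matrix.smul_one_eq_diagonal]
    exact Matrix.posDef_diagonal_iff.mpr fun _ => Complex.zero_lt_real.mpr hκ0
  -- the form bound on `E`
  have hF : ∀ u ∈ E, (star u ⬝ᵥ (T *ᵥ u)).re ≤ ∑ i, W i * ‖u i‖ ^ 2 := by
    intro u hu
    have h1 : (star u ⬝ᵥ (T *ᵥ u)).re = (star u ⬝ᵥ (Tn *ᵥ u)).re + κ * ∑ i, ‖u i‖ ^ 2 := by
      rw [hTdef, Matrix.add_mulVec, dotProduct_add, Complex.add_re, Matrix.smul_mulVec,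
        Matrix.one_mulVec, dotProduct_smul, smul_eq_mul, Complex.re_ofReal_mul,
        Summit.QuantumFields.QCD.Theorems.HeatSlicedQuarks.sum_norm_sq_eq_re_star_dotProduct]
    have h2 : (star u ⬝ᵥ (Tn *ᵥ u)).re ≤
        4 * (∑ i, ‖(wilsonDirac ρ₃ U m 1 *ᵥ u) i‖ ^ 2) +
          C_A * ∑ x : TorusSite 4 L, curv x * ∑ a : Fin 3, ∑ α : Fin 4, ‖u (x, a, α)‖ ^ 2 :=
      hA L U m u
    have h3 : ∑ i, ‖(wilsonDirac ρ₃ U m 1 *ᵥ u) i‖ ^ 2 ≤ lam * ∑ i, ‖u i‖ ^ 2 := hE u hu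
    have hsite0 : 0 ≤ ∑ x : TorusSite 4 L, curv x * ∑ a : Fin 3, ∑ α : Fin 4, ‖u (x, a, α)‖ ^ 2 :=
      Finset.sum_nonneg fun x _ => mul_nonneg (hcurv0 x)
        (Finset.sum_nonneg fun _ _ => Finset.sum_nonneg fun _ _ => by positivity)
    have h4 : C_A * ∑ x : TorusSite 4 L, curv x * ∑ a : Fin 3, ∑ α : Fin 4, ‖u (x, a, α)‖ ^ 2 ≤
        CA * ∑ x : TorusSite 4 L, curv x * ∑ a : Fin 3, ∑ α : Fin 4, ‖u (x, a, α)‖ ^ 2 :=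
      mul_le_mul_of_nonneg_right hCA hsite0
    have h5 : ∑ i, W i * ‖u i‖ ^ 2 =
        4 * lam * ∑ i, ‖u i‖ ^ 2 +
          CA * ∑ x : TorusSite 4 L, curv x * ∑ a : Fin 3, ∑ α : Fin 4, ‖u (x, a, α)‖ ^ 2 +
            κ * ∑ i, ‖u i‖ ^ 2 := by
      have e1 : ∑ i, W i * ‖u i‖ ^ 2 =
          ∑ i, (4 * lam * ‖u i‖ ^ 2 + CA * (curv i.1 * ‖u i‖ ^ 2) + κ * ‖u i‖ ^ 2) :=
        Finset.sum_congr rfl fun i _ => by rw [hWdef]; ring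
      have e2 : ∑ i : TorusSite 4 L × Fin 3 × Fin 4, curv i.1 * ‖u i‖ ^ 2 =
          ∑ x : TorusSite 4 L, curv x * ∑ a : Fin 3, ∑ α : Fin 4, ‖u (x, a, α)‖ ^ 2 := by
        rw [Fintype.sum_prod_type]
        refine Finset.sum_congr rfl fun x _ => ?_
        rw [Fintype.sum_prod_type, Finset.mul_sum]
        refine Finset.sum_congr rfl fun a _ => ?_
        rw [Finset.mul_sum]
      rw [e1, Finset.sum_add_distrib, Finset.sum_add_distrib, ← Finset.mul_sum, ← Finset.mul_sum,
        ← Finset.mul_sum, e2]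
    have hu0 : 0 ≤ ∑ i, ‖u i‖ ^ 2 := Finset.sum_nonneg fun _ _ => by positivity
    rw [h1, h5]
    nlinarith [h2, h3, h4, hu0]
  -- the local Weyl law for `T`
  have hLW : ∀ E' : ℝ, 0 < E' → ∀ i : TorusSite 4 L × Fin 3 × Fin 4,
      ((((T + (E' : ℂ) • (1 : Matrix (TorusSite 4 L × Fin 3 × Fin 4) (TorusSite 4 L × Fin 3 × Fin 4) ℂ))⁻¹) ^ 4)
        i i).re ≤ 2 * K1 / E' ^ 2 := by
    rintro E' hE' ⟨x, a, α⟩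
    have hε : 0 < κ + E' := by linarith
    have hTE : T + (E' : ℂ) • (1 : Matrix (TorusSite 4 L × Fin 3 × Fin 4) (TorusSite 4 L × Fin 3 × Fin 4) ℂ) =
        Tn + ((κ + E' : ℝ) : ℂ) •
          (1 : Matrix (TorusSite 4 L × Fin 3 × Fin 4) (TorusSite 4 L × Fin 3 × Fin 4) ℂ) := by
      rw [hTdef, add_assoc, ← add_smul]
      push_cast
      rfl
    rw [hTE]
    have h1 := hdom L U (κ + E') hε x a α
    have h2 := hfou L (κ + E') hε x
    have h3 := hK₁ L (κ + E') hε
    refine (Complex.re_le_norm _).trans (h1.trans (h2.trans (h3.trans ?_)))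
    -- `K₁ (1/(κ+E')² + 1/((κ+E')⁴ L⁴)) ≤ 2 K1 / E'²`
    have hpos : 0 ≤ 1 / (κ + E') ^ 2 + 1 / ((κ + E') ^ 4 * (L : ℝ) ^ 4) := by positivity
    have hE2 : 0 < E' ^ 2 := by positivity
    have hA1 : 1 / (κ + E') ^ 2 ≤ 1 / E' ^ 2 :=
      one_div_le_one_div_of_le hE2 (pow_le_pow_left₀ hE'.le (by linarith) 2)
    have hA2 : 1 / ((κ + E') ^ 4 * (L : ℝ) ^ 4) ≤ 1 / E' ^ 2 := by
      refine one_div_le_one_div_of_le hE2 ?_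
      have hfour : 6 * κ ^ 2 * E' ^ 2 ≤ (κ + E') ^ 4 := by
        have hrest : 0 ≤ κ ^ 4 + 4 * κ ^ 3 * E' + 4 * κ * E' ^ 3 + E' ^ 4 := by positivity
        nlinarith [hrest]
      calc E' ^ 2 ≤ 6 * E' ^ 2 := by nlinarith
        _ = 6 * κ ^ 2 * E' ^ 2 * (L : ℝ) ^ 4 := by
            calc 6 * E' ^ 2 = 6 * E' ^ 2 * (κ * (L : ℝ) ^ 2) ^ 2 := by rw [hκL]; ring
              _ = 6 * κ ^ 2 * E' ^ 2 * (L : ℝ) ^ 4 := by ring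
        _ ≤ (κ + E') ^ 4 * (L : ℝ) ^ 4 := by
            exact mul_le_mul_of_nonneg_right hfour (by positivity)
    calc K₁ * (1 / (κ + E') ^ 2 + 1 / ((κ + E') ^ 4 * (L : ℝ) ^ 4))
        ≤ K1 * (1 / (κ + E') ^ 2 + 1 / ((κ + E') ^ 4 * (L : ℝ) ^ 4)) :=
          mul_le_mul_of_nonneg_right hK1 hpos
      _ ≤ K1 * (1 / E' ^ 2 + 1 / E' ^ 2) := by gcongr
      _ = 2 * K1 / E' ^ 2 := by ring
  -- the abstract CLR
  have hmain := hc₁ T hT (2 * K1) (by positivity) hLW W hW E hF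
  -- bookkeeping: `Σ_i W_i² ≤ 36 (16 λ² L⁴ + CA² CB S_W + 1)`
  have hS0 : 0 ≤ wilsonAction ρ₃ U :=
    Summit.QuantumFields.QCD.Theorems.ActionBoundsLowModes.Negative.wilsonAction_nonneg L U
  have hcurv2 : ∑ x, curv x ^ 2 ≤ CB * wilsonAction ρ₃ U :=
    (hB L U).trans (mul_le_mul_of_nonneg_right hCB hS0)
  have hW2 : ∑ i, W i ^ 2 ≤ 36 * (16 * (lam ^ 2 * (L : ℝ) ^ 4) + CA ^ 2 * (CB * wilsonAction ρ₃ U) + 1) := by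
    have e1 : ∀ i : TorusSite 4 L × Fin 3 × Fin 4,
        W i ^ 2 ≤ 3 * (16 * lam ^ 2 + CA ^ 2 * curv i.1 ^ 2 + κ ^ 2) := fun i => by
      rw [hWdef]
      nlinarith [sq_nonneg (4 * lam - CA * curv i.1), sq_nonneg (4 * lam - κ),
        sq_nonneg (CA * curv i.1 - κ)]
    have e2 : ∑ i : TorusSite 4 L × Fin 3 × Fin 4, 3 * (16 * lam ^ 2 + CA ^ 2 * curv i.1 ^ 2 + κ ^ 2) =
        36 * (16 * lam ^ 2 * (L : ℝ) ^ 4 + CA ^ 2 * ∑ x, curv x ^ 2 + κ ^ 2 * (L : ℝ) ^ 4) := by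
      rw [glue_sum_site_twelve (fun x => 3 * (16 * lam ^ 2 + CA ^ 2 * curv x ^ 2 + κ ^ 2))]
      have e3 : ∑ x : TorusSite 4 L, 3 * (16 * lam ^ 2 + CA ^ 2 * curv x ^ 2 + κ ^ 2) =
          3 * (16 * lam ^ 2 * (L : ℝ) ^ 4 + CA ^ 2 * ∑ x, curv x ^ 2 + κ ^ 2 * (L : ℝ) ^ 4) := by
        rw [← Finset.mul_sum, Finset.sum_add_distrib, Finset.sum_add_distrib, Finset.sum_const,
          Finset.sum_const, nsmul_eq_mul, nsmul_eq_mul,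
          Summit.QuantumFields.QCD.Cruxes.TipNoBinding.PositivityNoLeakSpread.card_torusSite_four, ← Finset.mul_sum]
        ring
      rw [e3]
      ring
    have e3 : κ ^ 2 * (L : ℝ) ^ 4 = 1 := by
      calc κ ^ 2 * (L : ℝ) ^ 4 = (κ * (L : ℝ) ^ 2) ^ 2 := by ring
        _ = 1 := by rw [hκL]; norm_num
    calc ∑ i, W i ^ 2 ≤ ∑ i : TorusSite 4 L × Fin 3 × Fin 4,
          3 * (16 * lam ^ 2 + CA ^ 2 * curv i.1 ^ 2 + κ ^ 2) := Finset.sum_le_sum fun i _ => e1 i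
      _ = 36 * (16 * lam ^ 2 * (L : ℝ) ^ 4 + CA ^ 2 * ∑ x, curv x ^ 2 + κ ^ 2 * (L : ℝ) ^ 4) := e2
      _ ≤ 36 * (16 * (lam ^ 2 * (L : ℝ) ^ 4) + CA ^ 2 * (CB * wilsonAction ρ₃ U) + 1) := by
          rw [e3, mul_assoc 16]
          gcongr
  -- conclude
  have hX0 : 0 ≤ lam ^ 2 * (L : ℝ) ^ 4 + wilsonAction ρ₃ U + 1 := by positivity
  have hsumW0 : 0 ≤ ∑ i, W i ^ 2 := Finset.sum_nonneg fun _ _ => sq_nonneg _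
  calc (Module.finrank ℂ E : ℝ) ≤ c₁ * (2 * K1) * ∑ i, W i ^ 2 := hmain
    _ ≤ c1 * (2 * K1) * ∑ i, W i ^ 2 :=
        mul_le_mul_of_nonneg_right (mul_le_mul_of_nonneg_right hc1 (by positivity)) hsumW0
    _ ≤ c1 * (2 * K1) * (36 * (16 * (lam ^ 2 * (L : ℝ) ^ 4) + CA ^ 2 * (CB * wilsonAction ρ₃ U) + 1)) :=
        mul_le_mul_of_nonneg_left hW2 (by positivity)
    _ ≤ c1 * (2 * K1) * (36 * ((16 + CA ^ 2 * CB + 1) * (lam ^ 2 * (L : ℝ) ^ 4 + wilsonAction ρ₃ U + 1))) := by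
        gcongr
        nlinarith [sq_nonneg CA, mul_nonneg (mul_nonneg (sq_nonneg CA) hCB0) hX0, hS0,
          mul_nonneg (sq_nonneg lam) (pow_nonneg hL0.le 4),
          mul_nonneg (mul_nonneg (sq_nonneg CA) hCB0) (mul_nonneg (sq_nonneg lam) (pow_nonneg hL0.le 4)),
          mul_nonneg (mul_nonneg (sq_nonneg CA) hCB0) hS0]
    _ = 36 * c1 * (2 * K1) * (16 + CA ^ 2 * CB + 1) *
          (lam ^ 2 * (L : ℝ) ^ 4 + wilsonAction ρ₃ U + 1) := by ring

end Summit.QuantumFields.QCD.Cruxes.ActionBoundsLowModes.DropTheWilsonSquare
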